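import Literature.Barriers.QuantumAdvantage.AaronsonChenSimulation
import Literature.Barriers.QuantumAdvantage.AaronsonChenPosterior
import Literature.Computability.QuantumComplexity.OracleGateReplacement
import HarnessLib

/-!
# Aaronson–Chen 2017, Lemma 5.3: proof of the probabilistic half (`aaronsonChen2017_lem53_losses_holds`)

Sibling proof file (D-0014) of `AaronsonChenSimulation.lean`. It PROVES the named fact
`aaronsonChen2017_lem53_losses` (the probabilistic analysis in the proof of Lemma 5.3 of

* S. Aaronson, L. Chen, *Complexity-theoretic foundations of quantum supremacy experiments*,
  CCC 2017 (arXiv:1612.05903) [AaronsonChen2017], §5.3, pp. 22–23),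

and hence reduces `aaronsonChen2017_lem53` to the single named fact
`aaronsonChen2017_lem53_machine` (`aaronsonChen2017_lem53_of_machine`).

**The printed argument** (pp. 22–23). For the `t`-th `O`-gate, after the queries,
`X = Σ_p X_p` with independent `X_p ∈ [0, τ]` and `μ ≤ 2^{-n}` under the posterior; the Chernoff
bound (Cor. 2.7) with `τ = ε⁴/(96T²(2n + ε⁻¹ + ln T))` gives, "with probability
`1 − exp(−(2n + ε⁻¹ + ln T)) = 1 − exp(−(2n + ε⁻¹))/T`", `‖(U_f − U_g) ⊗ I|v⟩‖ ≤ ε²/2T` (eq. (9));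
small tables (`32T²ε⁻⁴ ≥ 2ⁿ`) are queried entirely; "So by a simple union bound, with probability
at least `1 − exp(−(2n + ε⁻¹))`, the above bound holds for all `t ∈ [T]`", and eq. (10) sums the
errors.

**What is proved here**, on the coin space of `𝒟_O` (`acCoinMeasure`, `acOracleOf`), for the
tree's process `AcSim.step/run/losses` (`AaronsonChenSimulation.lean`) and with the per-transcript
Chernoff bound of `AaronsonChenPosterior.lean`:

* *locality of the process* (`AcSim.IsLocal`, `isLocal_const`, `IsLocal.step`): a stage, as a
  function of the oracle, is determined by the oracle's values on its own (finite, short) known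
  set — the process is a deterministic adaptive query strategy; `AcSim.length_losses` (one error
  term per query gate);
* *the error term as a string sum* (`queryWeight_unknownOnes_eq`: `X = Σ_{w unknown} [w ∈ O]·Q(1w)`,
  `sum_queryWeight_cons_le`: total weight `≤ ‖v‖² = 1`);
* *one gate* (`AcSim.transcriptAt`, `AcSim.lossAt`, `IsLocal.transcriptAt_eq_of_forall_iff`,
  `IsLocal.finite_transcripts`, **`IsLocal.measureReal_lossAt_gt_le`**): the coin space is covered by
  the knowledge events of the finitely many transcripts `(K, A)` at the gate, which are pairwise
  disjoint and on each of which the stage — hence the weights — is that of any witness, the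
  unknown strings are not heavy (`Q < 1/a`) and carry total weight `≤ 1`; so
  `Pr[X_t > θ] ≤ Σ_κ Pr[C_κ]·exp(−(θ − (e−1)2^{-n})·a) ≤ exp(−(θ − (e−1)2^{-n})·a)`; odd tail
  lengths, no query wire, and small tables give `X_t = 0` (`lossAt_eq_zero_of_not_even`,
  `lossAt_eq_zero_of_small`);
* *the union bound along the gates* (`AcSim.gateBound`, `IsLocal.measureReal_lossOf_gt_le`,
  **`IsLocal.measureReal_exists_loss_gt_le`**, `sum_map_gateBound_le`);
* *the constants* (`param_arith`, **`AcSim.gateBound_oracle_le`**): with `c = 14`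
  (`a = b = B¹⁴`, `B = |input| + T + 2 ≥ 2|x| + k + T + 4`) and `θ = 1/(16k²T²)`, a large table
  (`2^{2n} > B¹⁴`) has `(e−1)·2^{-n} ≤ 2B^{-7} ≤ θ/2` and `θB¹⁴/2 ≥ B ≥ 2|x| + k + ln T`, so every gate
  bound is `≤ exp(−(2|x| + k))/T`;
* **`aaronsonChen2017_lem53_losses_holds`**: `T` gate bounds sum to `exp(−(2|x| + k))`; off the bad
  event every `X_t ≤ θ` and `Σ_t 2√X_t ≤ 2T√θ = 1/2k` (`sum_map_two_mul_sqrt_le_of_forall_le`);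
  complement and push-forward to `𝒟_O` (`Measure.le_map_apply`); and
  **`aaronsonChen2017_lem53_of_machine`**.

## Design notes

* Everything is proved on the coin space and transported at the end by
  `μ(f⁻¹ E) ≤ (f_* μ)(E)`, so no measurability of the good event in `𝒟_O` is needed; on the coin
  space only the knowledge events (finite intersections of coordinate events) are measured exactly.
* The decomposition over transcripts is a finite union (transcripts are pairs of sets of strings
  shorter than the register), bounded by the sum (no measurability), while the knowledge events of
  distinct reachable transcripts are disjoint measurable sets whose probabilities add up to `≤ 1`.

## Sources

* [AaronsonChen2017] arXiv:1612.05903, read via `lit read arxiv:1612.05903 --pages 19-25`: §5.3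
  pp. 22–23 (posterior, Chernoff step, small tables, eq. (9), union bound, eq. (10)).
* [BennettBernsteinBrassardVazirani1997] Cor. 3.4 (proof: disjoint query events), as proved in
  the tree's `HybridArgument.lean` (`sum_queryWeight_singleton_le`).
-/

noncomputable section

namespace Literature.Barriers.QuantumAdvantage

open MeasureTheory _root_.Computability Matrix Literature.Computability.Complexity
  Literature.Computability.Cryptography Literature.Computability.QuantumComplexity
open scoped Classical

variable {G : QGateSet} {N : ℕ}

/-! ### Locality of the replacement process -/

namespace AcSim

/-- A stage of the process as a function of the oracle is LOCAL if it is determined by the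
oracle's values on its own known set, its known strings are shorter than the register, and its
state is a unit vector. (The process is a deterministic adaptive query strategy: "`f_known`"
determines everything computed so far.) [cite: AaronsonChen2017, §5.3 (p. 22)] -/
structure IsLocal (σ : Set (List Bool) → State N) : Prop where
  /-- Oracles agreeing on the known set give the same stage. -/
  locality : ∀ O O' : Set (List Bool), (∀ w ∈ (σ O).known, (w ∈ O ↔ w ∈ O')) → σ O' = σ O
  /-- Known strings are shorter than the number of wires. -/
  length_lt : ∀ (O : Set (List Bool)), ∀ w ∈ (σ O).known, w.length < N
  /-- The state vector is a unit vector. -/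
  normSq_eq : ∀ O : Set (List Bool), normSq (σ O).vec = 1

/-- A constant initial stage with empty knowledge and a unit vector is local. [folklore] -/
theorem isLocal_const {ψ : QReg N → ℂ} (hψ : normSq ψ = 1) :
    IsLocal (fun _ : Set (List Bool) => (⟨∅, ψ⟩ : State N)) where
  locality := fun _ _ _ => rfl
  length_lt := fun _ w hw => absurd hw (Set.notMem_empty w)
  normSq_eq := fun _ => hψ

/-- The knowledge only grows along one gate. [folklore] -/
theorem known_subset_step_known (O : Set (List Bool)) (a b : ℕ) (s : State N) (g : QGate G N) :
    s.known ⊆ (step O a b s g).known := by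
  cases g with
  | gate g e => exact subset_rfl
  | oracle k e => exact Set.subset_union_left

/-- Heavy tails are shorter than the register. [folklore] -/
theorem length_lt_of_mem_heavySet {a k : ℕ} {e : Fin (k + 1) ↪ Fin N} {φ : QReg N → ℂ} {w : List Bool}
    (hw : w ∈ heavySet a e φ) : w.length < N := by
  have hk : k + 1 ≤ N := by simpa using Fintype.card_le_of_embedding e
  have := hw.1
  omega

/-- Small-table tails are shorter than the register. [folklore] -/
theorem length_lt_of_mem_smallSet {b k : ℕ} (e : Fin (k + 1) ↪ Fin N) {w : List Bool}
    (hw : w ∈ smallSet b k) : w.length < N := by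
  have hk : k + 1 ≤ N := by simpa using Fintype.card_le_of_embedding e
  have := hw.1
  omega

/-- **Locality is preserved by one gate of the process.** [cite: AaronsonChen2017, §5.3 (p. 22)] -/
theorem IsLocal.step (hG : G.IsUnitary) {σ : Set (List Bool) → State N} (hσ : IsLocal σ)
    (a b : ℕ) (g : QGate G N) : IsLocal fun O => AcSim.step O a b (σ O) g where
  locality := by
    intro O O' h
    have hσO : σ O' = σ O :=
      hσ.locality O O' fun w hw => h w (known_subset_step_known O a b (σ O) g hw)
    cases g with
    | gate g e => simp only [AcSim.step, hσO]
    | oracle k e =>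
      simp only [AcSim.step, hσO]
      have hOK : (O' ∩ newKnown a b (σ O) e : Set (List Bool)) = O ∩ newKnown a b (σ O) e := by
        ext w
        simp only [Set.mem_inter_iff]
        constructor
        · rintro ⟨hw, hK⟩; exact ⟨(h w hK).2 hw, hK⟩
        · rintro ⟨hw, hK⟩; exact ⟨(h w hK).1 hw, hK⟩
      rw [hOK]
  length_lt := by
    intro O w hw
    cases g with
    | gate g e => exact hσ.length_lt O w hw
    | oracle k e =>
      rcases hw with hw | hw | hw
      · exact hσ.length_lt O w hw
      · exact length_lt_of_mem_heavySet hw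
      · exact length_lt_of_mem_smallSet e hw
  normSq_eq := fun O => (normSq_step_vec hG O a b (σ O) g).trans (hσ.normSq_eq O)

/-- The known set of a local stage is finite. [folklore] -/
theorem IsLocal.finite_known {σ : Set (List Bool) → State N} (hσ : IsLocal σ) (O : Set (List Bool)) :
    (σ O).known.Finite :=
  (List.finite_length_lt Bool N).subset fun w hw => hσ.length_lt O w hw

/-- There is one error term per oracle gate. [folklore] -/
theorem length_losses (O : Set (List Bool)) (a b : ℕ) :
    ∀ (gs : List (QGate G N)) (s : State N), (losses O a b gs s).length = (⟨gs⟩ : QCircuit G N).oracleQueries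
  | [], _ => rfl
  | g :: gs, s => by
    have ih := length_losses O a b gs (AcSim.step O a b s g)
    unfold QCircuit.oracleQueries at ih ⊢
    cases g with
    | gate g e =>
      rw [losses_cons, List.length_append, ih, List.filter_cons_of_neg (by simp [QGate.IsOracleFree])]
      simp [lossOf]
    | oracle k e =>
      rw [losses_cons, List.length_append, ih, List.filter_cons_of_pos (by simp [QGate.IsOracleFree]),
        List.length_cons]
      simp [lossOf]
      omega

end AcSim

/-! ### The error term of a gate as a sum over the unknown strings -/

/-- The length of a query string is the number of query wires. [folklore] -/
theorem length_queryOf {k : ℕ} (e : Fin (k + 1) ↪ Fin N) (x : QReg N) : (queryOf e x).length = k := by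
  simp [queryOf]

/-- **The error term as a string sum**: the query magnitude of the unknown `1`s is
`X = Σ_{w unknown} [w ∈ O] · Q(1w)`, `Q(1w)` the query magnitude of the single query `1w`
("`X = Σ_{x ∈ {0,1}^{2n}} Q(x)·[f(x) ≠ g(x)]`"). [cite: AaronsonChen2017, §5.3 (p. 22)] -/
theorem queryWeight_unknownOnes_eq (O K : Set (List Bool)) {k : ℕ} (e : Fin (k + 1) ↪ Fin N)
    (φ : QReg N → ℂ) :
    queryWeight (AcSim.unknownOnes O K) e φ =
      ∑ w ∈ (stringsOfLen (k - 1)).filter (· ∉ K),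
        if w ∈ O then queryWeight ({true :: w} : Set (List Bool)) e φ else 0 := by
  have hR : ∀ w : List Bool, (if w ∈ O then queryWeight ({true :: w} : Set (List Bool)) e φ else 0) =
      ∑ x : QReg N, if (w ∈ O ∧ queryOf e x = true :: w) then ‖φ x‖ ^ 2 else 0 := by
    intro w
    by_cases hw : w ∈ O
    · simp only [hw, if_true, true_and, queryWeight, Set.mem_singleton_iff]
    · simp [hw]
  have hpt : ∀ x : QReg N, (if queryOf e x ∈ AcSim.unknownOnes O K then ‖φ x‖ ^ 2 else 0) =
      ∑ w ∈ (stringsOfLen (k - 1)).filter (· ∉ K),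
        if (w ∈ O ∧ queryOf e x = true :: w) then ‖φ x‖ ^ 2 else 0 := by
    intro x
    have hlen := length_queryOf e x
    cases hq : queryOf e x with
    | nil => simp [AcSim.unknownOnes]
    | cons c w₀ =>
      rw [hq, List.length_cons] at hlen
      cases c
      · simp [AcSim.unknownOnes]
      · have hmem : (true :: w₀ ∈ AcSim.unknownOnes O K) ↔ (w₀ ∈ O ∧ w₀ ∉ K) := by
          simp only [AcSim.unknownOnes, Set.mem_setOf_eq, List.cons.injEq, true_and]
          constructor
          · rintro ⟨w, rfl, h⟩; exact h
          · intro h; exact ⟨w₀, rfl, h⟩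
        have hsum : ∑ w ∈ (stringsOfLen (k - 1)).filter (· ∉ K),
            (if (w ∈ O ∧ true :: w₀ = true :: w) then ‖φ x‖ ^ 2 else 0) =
              ∑ w ∈ (stringsOfLen (k - 1)).filter (· ∉ K),
                (if w₀ = w then (if w₀ ∈ O then ‖φ x‖ ^ 2 else 0) else 0) := by
          refine Finset.sum_congr rfl fun w _ => ?_
          by_cases h : w₀ = w
          · subst h; simp
          · have h' : ¬ (w ∈ O ∧ true :: w₀ = true :: w) := fun hh => h (List.cons.inj hh.2).2
            rw [if_neg h', if_neg h]
        rw [hmem, hsum, Finset.sum_ite_eq]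
        have hW : (w₀ ∈ (stringsOfLen (k - 1)).filter (· ∉ K)) ↔ w₀ ∉ K := by
          simp only [Finset.mem_filter, mem_stringsOfLen, and_iff_right_iff_imp]
          intro _; omega
        simp only [hW]
        by_cases h1 : w₀ ∈ O <;> by_cases h2 : w₀ ∈ K <;> simp [h1, h2]
  calc queryWeight (AcSim.unknownOnes O K) e φ
      = ∑ x : QReg N, if queryOf e x ∈ AcSim.unknownOnes O K then ‖φ x‖ ^ 2 else 0 := rfl
    _ = ∑ x : QReg N, ∑ w ∈ (stringsOfLen (k - 1)).filter (· ∉ K),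
          if (w ∈ O ∧ queryOf e x = true :: w) then ‖φ x‖ ^ 2 else 0 := Finset.sum_congr rfl fun x _ => hpt x
    _ = ∑ w ∈ (stringsOfLen (k - 1)).filter (· ∉ K), ∑ x : QReg N,
          if (w ∈ O ∧ queryOf e x = true :: w) then ‖φ x‖ ^ 2 else 0 := Finset.sum_comm
    _ = _ := Finset.sum_congr rfl fun w _ => (hR w).symm

/-- **The weights of distinct unknown strings add up to at most the squared norm** (distinct query
strings have disjoint query events). [cite: BennettBernsteinBrassardVazirani1997, Cor. 3.4 (proof)] -/
theorem sum_queryWeight_cons_le {k : ℕ} (W : Finset (List Bool)) (e : Fin (k + 1) ↪ Fin N) (φ : QReg N → ℂ) :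
    ∑ w ∈ W, queryWeight ({true :: w} : Set (List Bool)) e φ ≤ normSq φ := by
  have h := sum_queryWeight_singleton_le (W.image (true :: ·)) e φ
  rwa [Finset.sum_image (fun w _ w' _ h => (List.cons.inj h).2)] at h

/-! ### One query gate from a local stage: transcripts -/

namespace AcSim

variable {σ : Set (List Bool) → State N}

/-- The transcript of the oracle `O` at a query gate (query wires `e`) processed from the stage
`σ O`: the knowledge after the gate's queries and the `1`s among it ("`f_known`").
[cite: AaronsonChen2017, §5.3 (p. 22)] -/
def transcriptAt (σ : Set (List Bool) → State N) (a b : ℕ) {k : ℕ} (e : Fin (k + 1) ↪ Fin N)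
    (O : Set (List Bool)) : Set (List Bool) × Set (List Bool) :=
  (newKnown a b (σ O) e, O ∩ newKnown a b (σ O) e)

/-- The error term of the oracle `O` at a query gate processed from the stage `σ O`.
[cite: AaronsonChen2017, §5.3 (p. 22, eq. (8))] -/
def lossAt (σ : Set (List Bool) → State N) (a b : ℕ) {k : ℕ} (e : Fin (k + 1) ↪ Fin N)
    (O : Set (List Bool)) : ℝ :=
  queryWeight (unknownOnes O (newKnown a b (σ O) e)) e (σ O).vec

/-- The error term of a query gate is the single entry of `lossOf` (definitional). [folklore] -/
theorem lossOf_oracle_eq (σ : Set (List Bool) → State N) (a b : ℕ) {k : ℕ} (e : Fin (k + 1) ↪ Fin N)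
    (O : Set (List Bool)) : lossOf O a b (σ O) (QGate.oracle (G := G) k e) = [lossAt σ a b e O] := rfl

/-- The strings of the new knowledge are shorter than the register. [folklore] -/
theorem IsLocal.length_lt_of_mem_newKnown (hσ : IsLocal σ) (a b : ℕ) {k : ℕ} (e : Fin (k + 1) ↪ Fin N)
    (O : Set (List Bool)) {w : List Bool} (hw : w ∈ newKnown a b (σ O) e) : w.length < N := by
  rcases hw with hw | hw | hw
  · exact hσ.length_lt O w hw
  · exact length_lt_of_mem_heavySet hw
  · exact length_lt_of_mem_smallSet e hw

/-- **Locality at a gate**: an oracle agreeing with `O` on the new knowledge of `O` has the same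
stage. [cite: AaronsonChen2017, §5.3 (p. 22)] -/
theorem IsLocal.eq_of_agree_newKnown (hσ : IsLocal σ) (a b : ℕ) {k : ℕ} (e : Fin (k + 1) ↪ Fin N)
    {O O' : Set (List Bool)} (h : ∀ w ∈ newKnown a b (σ O) e, (w ∈ O ↔ w ∈ O')) : σ O' = σ O :=
  hσ.locality O O' fun w hw => h w (Set.subset_union_left (s := (σ O).known) hw)

/-- Hence such an oracle has the same new knowledge, and if it also has the same `1`s there, the
same transcript. [cite: AaronsonChen2017, §5.3 (p. 22)] -/
theorem IsLocal.transcriptAt_eq_of_agree (hσ : IsLocal σ) (a b : ℕ) {k : ℕ} (e : Fin (k + 1) ↪ Fin N)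
    {O O' : Set (List Bool)} (h : ∀ w ∈ newKnown a b (σ O) e, (w ∈ O ↔ w ∈ O')) :
    transcriptAt σ a b e O' = transcriptAt σ a b e O := by
  have hσO := hσ.eq_of_agree_newKnown a b e h
  unfold transcriptAt
  rw [hσO]
  congr 1
  ext w
  exact ⟨fun ⟨hw, hK⟩ => ⟨(h w hK).2 hw, hK⟩, fun ⟨hw, hK⟩ => ⟨(h w hK).1 hw, hK⟩⟩

/-- Oracles with the same transcript have the same stage. [cite: AaronsonChen2017, §5.3 (p. 22)] -/
theorem IsLocal.eq_of_transcriptAt_eq (hσ : IsLocal σ) (a b : ℕ) {k : ℕ} (e : Fin (k + 1) ↪ Fin N)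
    {O O' : Set (List Bool)} (h : transcriptAt σ a b e O' = transcriptAt σ a b e O) : σ O' = σ O := by
  refine hσ.eq_of_agree_newKnown a b e fun w hw => ?_
  have h1 : newKnown a b (σ O') e = newKnown a b (σ O) e := congrArg Prod.fst h
  have h2 : O' ∩ newKnown a b (σ O') e = O ∩ newKnown a b (σ O) e := congrArg Prod.snd h
  rw [h1] at h2
  constructor
  · intro hO
    have : w ∈ O ∩ newKnown a b (σ O) e := ⟨hO, hw⟩
    rw [← h2] at this
    exact this.1
  · intro hO'
    have : w ∈ O' ∩ newKnown a b (σ O) e := ⟨hO', hw⟩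
    rw [h2] at this
    exact this.1

/-- **The knowledge event pins the transcript**: an oracle agreeing with the answers of a
transcript `(K, A)` of some oracle `O₀` on `K` has the same stage and the same transcript.
[cite: AaronsonChen2017, §5.3 (p. 22)] -/
theorem IsLocal.transcriptAt_eq_of_forall_iff (hσ : IsLocal σ) (a b : ℕ) {k : ℕ} (e : Fin (k + 1) ↪ Fin N)
    {O₀ O : Set (List Bool)}
    (h : ∀ w ∈ (transcriptAt σ a b e O₀).1, (w ∈ O ↔ w ∈ (transcriptAt σ a b e O₀).2)) :
    σ O = σ O₀ ∧ transcriptAt σ a b e O = transcriptAt σ a b e O₀ := by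
  have h' : ∀ w ∈ newKnown a b (σ O₀) e, (w ∈ O₀ ↔ w ∈ O) := fun w hw => by
    rw [h w hw]
    exact ⟨fun hO => ⟨hO, hw⟩, fun hA => hA.1⟩
  exact ⟨hσ.eq_of_agree_newKnown a b e h', hσ.transcriptAt_eq_of_agree a b e h'⟩

/-- The set of transcripts of all coin outcomes at a gate is finite (transcripts are pairs of sets
of strings shorter than the register). [folklore] -/
theorem IsLocal.finite_transcripts (hσ : IsLocal σ) (a b : ℕ) {k : ℕ} (e : Fin (k + 1) ↪ Fin N) :
    (Set.range fun S : Set AcCoin => transcriptAt σ a b e (acOracleOf S)).Finite := by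
  have hL : {w : List Bool | w.length < N}.Finite := List.finite_length_lt Bool N
  refine ((hL.finite_subsets).prod (hL.finite_subsets)).subset ?_
  rintro κ ⟨S, rfl⟩
  refine ⟨fun w hw => hσ.length_lt_of_mem_newKnown a b e _ hw, fun w hw => ?_⟩
  exact hσ.length_lt_of_mem_newKnown a b e _ hw.2

end AcSim

/-! ### One query gate from a local stage: the probability of a large error term -/

namespace AcSim

variable {σ : Set (List Bool) → State N}

/-- **The per-gate bound** ("over `O ∼ 𝒟_O`, for each `t ∈ [T]`, with probability
`1 − exp(−(2n + ε⁻¹))/T` …"): for a query gate with `2n` tail bits processed from a local stage with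
threshold `τ = 1/a`, the probability (over the coins) that the error term exceeds `θ` is at most
`exp(−(θ − (e−1)·2^{-n})·a)` — decompose the coin space by the finitely many transcripts `(K, A)`
at the gate; on the knowledge event of a transcript the stage, hence the weights `Q(1w)`, are
those of any witness (locality), the unknown strings are not heavy (`Q < 1/a`) and carry total
weight `≤ 1`, so the per-transcript Chernoff bound applies; the knowledge events of distinct
transcripts are disjoint, so their probabilities sum to at most `1`.
[cite: AaronsonChen2017, §5.3 (pp. 22–23, "Applying the Chernoff Bound" and eq. (9))] -/
theorem IsLocal.measureReal_lossAt_gt_le (hσ : IsLocal σ) {a : ℕ} (ha : 1 ≤ a) (b : ℕ) {k n : ℕ}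
    (e : Fin (k + 1) ↪ Fin N) (hk : k = 2 * n + 1) (θ : ℝ) :
    acCoinMeasure.real {S | θ < lossAt σ a b e (acOracleOf S)} ≤
      Real.exp (-(θ - (Real.exp 1 - 1) * 2⁻¹ ^ n) * a) := by
  have h𝒯fin : (Set.range fun S : Set AcCoin => transcriptAt σ a b e (acOracleOf S)).Finite :=
    hσ.finite_transcripts a b e
  have hL : {w : List Bool | w.length < N}.Finite := List.finite_length_lt Bool N
  -- the knowledge of a transcript, as a finite set
  let Kfin : Set (List Bool) × Set (List Bool) → Finset (List Bool) := fun κ => hL.toFinset.filter (· ∈ κ.1)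
  have hKfin : ∀ (S : Set AcCoin) (w : List Bool),
      w ∈ Kfin (transcriptAt σ a b e (acOracleOf S)) ↔ w ∈ newKnown a b (σ (acOracleOf S)) e := by
    intro S w
    simp only [Kfin, Finset.mem_filter, Set.Finite.mem_toFinset, Set.mem_setOf_eq, transcriptAt,
      and_iff_right_iff_imp]
    exact fun hw => hσ.length_lt_of_mem_newKnown a b e _ hw
  -- a witness coin outcome for every transcript
  have hex : ∀ κ ∈ h𝒯fin.toFinset, ∃ S : Set AcCoin, transcriptAt σ a b e (acOracleOf S) = κ := fun κ hκ => by
    simpa using hκ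
  choose! wit hwit using hex
  have hKfin' : ∀ κ ∈ h𝒯fin.toFinset, ∀ w : List Bool, w ∈ Kfin κ ↔ w ∈ κ.1 := by
    intro κ hκ w
    simp only [Kfin, Finset.mem_filter, Set.Finite.mem_toFinset, Set.mem_setOf_eq, and_iff_right_iff_imp]
    intro hw
    have h3 := hwit κ hκ
    rw [← h3] at hw
    exact hσ.length_lt_of_mem_newKnown a b e _ hw
  -- the weights of a transcript: those of the stage of its witness
  let Qw : Set (List Bool) × Set (List Bool) → List Bool → ℝ := fun κ w =>
    queryWeight ({true :: w} : Set (List Bool)) e (σ (acOracleOf (wit κ))).vec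
  have hτ : (0 : ℝ) < 1 / a := by
    have : (1 : ℝ) ≤ a := by exact_mod_cast ha
    positivity
  -- Step 1: the event is covered by the transcript events
  have hsub : {S | θ < lossAt σ a b e (acOracleOf S)} ⊆ ⋃ κ ∈ h𝒯fin.toFinset,
      (transcriptEvent (Kfin κ) κ.2 ∩ {S | θ ≤ transcriptLoss (Kfin κ) n (Qw κ) S}) := by
    intro S hS
    simp only [Set.mem_setOf_eq] at hS
    have hκmem : transcriptAt σ a b e (acOracleOf S) ∈ h𝒯fin.toFinset := by
      rw [Set.Finite.mem_toFinset]; exact ⟨S, rfl⟩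
    simp only [Set.mem_iUnion, Set.mem_inter_iff, Set.mem_setOf_eq, exists_prop]
    refine ⟨transcriptAt σ a b e (acOracleOf S), hκmem, ?_, ?_⟩
    · intro w hw
      rw [hKfin S w] at hw
      exact ⟨fun h => ⟨h, hw⟩, fun h => h.1⟩
    · have hσeq : σ (acOracleOf (wit (transcriptAt σ a b e (acOracleOf S)))) = σ (acOracleOf S) :=
        hσ.eq_of_transcriptAt_eq a b e (hwit _ hκmem)
      have hloss : lossAt σ a b e (acOracleOf S) =
          transcriptLoss (Kfin (transcriptAt σ a b e (acOracleOf S))) n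
            (Qw (transcriptAt σ a b e (acOracleOf S))) S := by
        unfold lossAt transcriptLoss unknownStrings
        rw [queryWeight_unknownOnes_eq]
        simp only [Qw, hσeq]
        rw [show k - 1 = 2 * n by omega]
        refine Finset.sum_congr (Finset.filter_congr fun w _ => ?_) fun w _ => rfl
        rw [hKfin S w]
      rw [← hloss]
      exact hS.le
  -- Step 2: the per-transcript Chernoff bound
  have hT : ∀ κ ∈ h𝒯fin.toFinset,
      acCoinMeasure.real (transcriptEvent (Kfin κ) κ.2 ∩ {S | θ ≤ transcriptLoss (Kfin κ) n (Qw κ) S}) ≤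
        acCoinMeasure.real (transcriptEvent (Kfin κ) κ.2) *
          Real.exp (-(θ - (Real.exp 1 - 1) * 2⁻¹ ^ n) * a) := by
    intro κ hκ
    have hK : ∀ w, w ∈ Kfin κ ↔ w ∈ newKnown a b (σ (acOracleOf (wit κ))) e := by
      intro w
      have h := hKfin (wit κ) w
      rwa [hwit κ hκ] at h
    have hQ0 : ∀ w ∈ unknownStrings (Kfin κ) n, 0 ≤ Qw κ w := fun w _ => queryWeight_nonneg _ _ _
    have hQτ : ∀ w ∈ unknownStrings (Kfin κ) n, Qw κ w ≤ 1 / a := by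
      intro w hw
      simp only [unknownStrings, Finset.mem_filter, mem_stringsOfLen] at hw
      obtain ⟨hl, hwK⟩ := hw
      rw [hK] at hwK
      have hnh : w ∉ heavySet a e (σ (acOracleOf (wit κ))).vec := fun h => hwK (Or.inr (Or.inl h))
      simp only [heavySet, Set.mem_setOf_eq, not_and, not_le] at hnh
      exact (hnh (by omega)).le
    have hQ1 : ∑ w ∈ unknownStrings (Kfin κ) n, Qw κ w ≤ 1 :=
      (sum_queryWeight_cons_le _ e _).trans (hσ.normSq_eq _).le
    have h := measureReal_transcriptEvent_inter_le (Kfin κ) κ.2 n (Qw κ) (1 / a) hτ hQ0 hQτ hQ1 θ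
    rwa [div_div_eq_mul_div, div_one] at h
  -- Step 3: the knowledge events of distinct transcripts are disjoint
  have key : ∀ κ ∈ h𝒯fin.toFinset, ∀ S : Set AcCoin, S ∈ transcriptEvent (Kfin κ) κ.2 →
      transcriptAt σ a b e (acOracleOf S) = κ := by
    intro κ hκ S hS
    rw [← hwit κ hκ]
    refine (hσ.transcriptAt_eq_of_forall_iff a b e (O₀ := acOracleOf (wit κ)) (O := acOracleOf S) ?_).2
    rw [hwit κ hκ]
    exact fun w hw => hS w ((hKfin' κ hκ w).2 hw)
  have hdisj : (h𝒯fin.toFinset : Set (Set (List Bool) × Set (List Bool))).PairwiseDisjoint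
      fun κ => transcriptEvent (Kfin κ) κ.2 := by
    intro κ₁ hκ₁ κ₂ hκ₂ hne
    rw [Function.onFun, Set.disjoint_iff]
    rintro S ⟨h1, h2⟩
    exact hne ((key κ₁ hκ₁ S h1).symm.trans (key κ₂ hκ₂ S h2))
  have hsum : ∑ κ ∈ h𝒯fin.toFinset, acCoinMeasure.real (transcriptEvent (Kfin κ) κ.2) ≤ 1 := by
    rw [← measureReal_biUnion_finset hdisj fun κ _ => measurableSet_transcriptEvent _ _]
    exact (measureReal_mono (Set.subset_univ _) (measure_ne_top _ _)).trans_eq probReal_univ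
  -- combine
  calc acCoinMeasure.real {S | θ < lossAt σ a b e (acOracleOf S)}
      ≤ acCoinMeasure.real (⋃ κ ∈ h𝒯fin.toFinset,
          (transcriptEvent (Kfin κ) κ.2 ∩ {S | θ ≤ transcriptLoss (Kfin κ) n (Qw κ) S})) :=
        measureReal_mono hsub (measure_ne_top _ _)
    _ ≤ ∑ κ ∈ h𝒯fin.toFinset,
          acCoinMeasure.real (transcriptEvent (Kfin κ) κ.2 ∩ {S | θ ≤ transcriptLoss (Kfin κ) n (Qw κ) S}) :=
        measureReal_biUnion_finset_le _ _
    _ ≤ ∑ κ ∈ h𝒯fin.toFinset, acCoinMeasure.real (transcriptEvent (Kfin κ) κ.2) *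
          Real.exp (-(θ - (Real.exp 1 - 1) * 2⁻¹ ^ n) * a) := Finset.sum_le_sum hT
    _ = (∑ κ ∈ h𝒯fin.toFinset, acCoinMeasure.real (transcriptEvent (Kfin κ) κ.2)) *
          Real.exp (-(θ - (Real.exp 1 - 1) * 2⁻¹ ^ n) * a) := (Finset.sum_mul _ _ _).symm
    _ ≤ 1 * Real.exp (-(θ - (Real.exp 1 - 1) * 2⁻¹ ^ n) * a) :=
        mul_le_mul_of_nonneg_right hsum (Real.exp_pos _).le
    _ = _ := one_mul _

/-- For a query gate with an odd number of tail bits, or no query wire, the error term vanishes on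
every coin outcome (the oracle has no odd-length strings). [cite: AaronsonChen2017, §5.2 (p. 20)] -/
theorem lossAt_eq_zero_of_not_even (σ : Set (List Bool) → State N) (a b : ℕ) {k : ℕ}
    (e : Fin (k + 1) ↪ Fin N) (hk : ¬ Even (k - 1) ∨ k = 0) (S : Set AcCoin) :
    lossAt σ a b e (acOracleOf S) = 0 := by
  unfold lossAt
  rw [queryWeight_unknownOnes_eq]
  refine Finset.sum_eq_zero fun w hw => ?_
  simp only [Finset.mem_filter, mem_stringsOfLen] at hw
  rcases hk with hk | hk
  · rw [if_neg]
    intro hwO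
    exact hk (hw.1 ▸ even_length_of_mem_acOracleOf hwO)
  · subst hk
    split_ifs
    · unfold queryWeight
      refine Finset.sum_eq_zero fun x _ => ?_
      rw [if_neg]
      intro h
      have := congrArg List.length (Set.mem_singleton_iff.1 h)
      simp [queryOf] at this
    · rfl

/-- If the whole length class is a small table, the error term vanishes (every string of the right
length is known). [cite: AaronsonChen2017, §5.3 (p. 22, "query all the positions in f_n")] -/
theorem lossAt_eq_zero_of_small (σ : Set (List Bool) → State N) (a b : ℕ) {k : ℕ}
    (e : Fin (k + 1) ↪ Fin N) (hk : 0 < k) (hb : 2 ^ (k - 1) ≤ b) (O : Set (List Bool)) :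
    lossAt σ a b e O = 0 := by
  unfold lossAt
  rw [queryWeight_unknownOnes_eq]
  refine Finset.sum_eq_zero fun w hw => ?_
  simp only [Finset.mem_filter, mem_stringsOfLen] at hw
  exfalso
  refine hw.2 (Or.inr (Or.inr ⟨by omega, ?_⟩))
  rw [hw.1]; exact hb

end AcSim

/-! ### Along the gate list: the union bound -/

namespace AcSim

variable {σ : Set (List Bool) → State N}

/-- The per-gate failure bound used in the union bound: zero for a gate symbol and for a query gate
whose error term vanishes identically (odd tail length, no query wire, or a small table), and the
Chernoff bound `exp(−(θ − (e−1)·2^{-n})·a)` for a query gate with `2n` tail bits and a large table.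
[cite: AaronsonChen2017, §5.3 (p. 23, eq. (9) and the union bound)] -/
def gateBound (θ : ℝ) (a b : ℕ) : QGate G N → ℝ
  | .gate _ _ => 0
  | .oracle k _ =>
    if Even (k - 1) ∧ 0 < k ∧ b < 2 ^ (k - 1) then
      Real.exp (-(θ - (Real.exp 1 - 1) * 2⁻¹ ^ ((k - 1) / 2)) * a)
    else 0

/-- Gate bounds are nonnegative. [folklore] -/
theorem gateBound_nonneg (θ : ℝ) (a b : ℕ) (g : QGate G N) : 0 ≤ gateBound θ a b g := by
  cases g with
  | gate g e => exact le_rfl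
  | oracle k e =>
    simp only [gateBound]
    split_ifs
    · exact (Real.exp_pos _).le
    · exact le_rfl

/-- **One gate**: the probability that the gate contributes an error term above `θ > 0` is at most
its gate bound. [cite: AaronsonChen2017, §5.3 (p. 23, eq. (9))] -/
theorem IsLocal.measureReal_lossOf_gt_le (hσ : IsLocal σ) {a : ℕ} (ha : 1 ≤ a) (b : ℕ) (g : QGate G N)
    {θ : ℝ} (hθ : 0 < θ) :
    acCoinMeasure.real {S | ∃ q ∈ lossOf (acOracleOf S) a b (σ (acOracleOf S)) g, θ < q} ≤
      gateBound θ a b g := by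
  cases g with
  | gate g e => simp [lossOf, gateBound]
  | oracle k e =>
    have hset : {S : Set AcCoin | ∃ q ∈ lossOf (acOracleOf S) a b (σ (acOracleOf S)) (QGate.oracle (G := G) k e), θ < q} =
        {S | θ < lossAt σ a b e (acOracleOf S)} := by
      ext S; simp [lossOf_oracle_eq]
    rw [hset]
    simp only [gateBound]
    split_ifs with h
    · obtain ⟨⟨m, hm⟩, hk, -⟩ := h
      have hk' : k = 2 * m + 1 := by omega
      have hdiv : (k - 1) / 2 = m := by omega
      rw [hdiv]
      exact hσ.measureReal_lossAt_gt_le ha b e hk' θ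
    · have hzero : ∀ S : Set AcCoin, lossAt σ a b e (acOracleOf S) = 0 := by
        intro S
        by_cases hk : k = 0
        · exact lossAt_eq_zero_of_not_even σ a b e (Or.inr hk) S
        by_cases hev : Even (k - 1)
        · have hb : 2 ^ (k - 1) ≤ b := by
            by_contra hb
            exact h ⟨hev, Nat.pos_of_ne_zero hk, not_le.1 hb⟩
          exact lossAt_eq_zero_of_small σ a b e (Nat.pos_of_ne_zero hk) hb _
        · exact lossAt_eq_zero_of_not_even σ a b e (Or.inl hev) S
      have : {S : Set AcCoin | θ < lossAt σ a b e (acOracleOf S)} = ∅ := by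
        ext S
        simp only [Set.mem_setOf_eq, Set.mem_empty_iff_false, iff_false, not_lt, hzero S]
        exact hθ.le
      rw [this, measureReal_empty]

/-- **The union bound along the gate list**: from a local stage, the probability that some error
term exceeds `θ > 0` is at most the sum of the gate bounds ("So by a simple union bound, with
probability at least `1 − exp(−(2n + ε⁻¹))`, the above bound holds for all `t ∈ [T]`").
[cite: AaronsonChen2017, §5.3 (p. 23)] -/
theorem IsLocal.measureReal_exists_loss_gt_le (hG : G.IsUnitary) {a : ℕ} (ha : 1 ≤ a) (b : ℕ) {θ : ℝ}
    (hθ : 0 < θ) :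
    ∀ (gs : List (QGate G N)) {σ : Set (List Bool) → State N}, IsLocal σ →
      acCoinMeasure.real {S | ∃ q ∈ losses (acOracleOf S) a b gs (σ (acOracleOf S)), θ < q} ≤
        (gs.map (gateBound θ a b)).sum
  | [], σ, _ => by simp
  | g :: gs, σ, hσ => by
    have ih := IsLocal.measureReal_exists_loss_gt_le hG ha b hθ gs (hσ.step hG a b g)
    have hg := hσ.measureReal_lossOf_gt_le ha b g hθ
    simp only [List.map_cons, List.sum_cons]
    calc acCoinMeasure.real {S | ∃ q ∈ losses (acOracleOf S) a b (g :: gs) (σ (acOracleOf S)), θ < q}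
        ≤ acCoinMeasure.real ({S | ∃ q ∈ lossOf (acOracleOf S) a b (σ (acOracleOf S)) g, θ < q} ∪
            {S | ∃ q ∈ losses (acOracleOf S) a b gs (AcSim.step (acOracleOf S) a b (σ (acOracleOf S)) g),
              θ < q}) := by
          refine measureReal_mono (fun S hS => ?_) (measure_ne_top _ _)
          simp only [Set.mem_setOf_eq, losses_cons, List.mem_append] at hS
          obtain ⟨q, hq | hq, hθq⟩ := hS
          · exact Or.inl ⟨q, hq, hθq⟩
          · exact Or.inr ⟨q, hq, hθq⟩
      _ ≤ _ := measureReal_union_le _ _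
      _ ≤ gateBound θ a b g + (gs.map (gateBound θ a b)).sum := add_le_add hg ih

/-- If every query gate of the list has gate bound at most `δ ≥ 0`, the gate bounds sum to at most
`T · δ`, `T` the number of query gates. [folklore] -/
theorem sum_map_gateBound_le {θ : ℝ} {a b : ℕ} {δ : ℝ} (hδ : 0 ≤ δ) :
    ∀ (gs : List (QGate G N)), (∀ k e, QGate.oracle k e ∈ gs → gateBound θ a b (QGate.oracle (G := G) k e) ≤ δ) →
      (gs.map (gateBound θ a b)).sum ≤ (⟨gs⟩ : QCircuit G N).oracleQueries * δ
  | [], _ => by simp [QCircuit.oracleQueries]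
  | g :: gs, h => by
    have ih := sum_map_gateBound_le hδ gs fun k e hmem => h k e (List.mem_cons_of_mem _ hmem)
    unfold QCircuit.oracleQueries at ih ⊢
    simp only [List.map_cons, List.sum_cons]
    cases g with
    | gate g e =>
      rw [List.filter_cons_of_neg (by simp [QGate.IsOracleFree])]
      simp only [gateBound, zero_add]
      exact ih
    | oracle k e =>
      rw [List.filter_cons_of_pos (by simp [QGate.IsOracleFree]), List.length_cons, Nat.cast_succ, add_mul,
        one_mul, add_comm]
      exact add_le_add ih (h k e List.mem_cons_self)

end AcSim

/-! ### The constants: `c = 14`, `θ = 1/(16 k² T²)` -/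


/-- `e − 1 ≤ 2`. [folklore] -/
theorem exp_one_sub_one_le_two : Real.exp 1 - 1 ≤ 2 := by
  have := Real.exp_one_lt_d9
  linarith

/-- **The arithmetic of the parameter choice**: with `B ≥ 4`, `1 ≤ k, T ≤ B` and `u·B⁷ ≤ 1`,
`B ≤ (1/(16k²T²) − 2u)·B¹⁴`. [cite: AaronsonChen2017, §5.3 (p. 22, choice of τ and the case δ ≤ 1)] -/
theorem param_arith {B k T u : ℝ} (hB : 4 ≤ B) (hk : 1 ≤ k) (hkB : k ≤ B) (hT : 1 ≤ T) (hTB : T ≤ B)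
    (hu : u * B ^ 7 ≤ 1) :
    B ≤ (1 / (16 * k ^ 2 * T ^ 2) - 2 * u) * B ^ 14 := by
  have hB0 : 0 < B := by linarith
  have hk0 : 0 < k := by linarith
  have hT0 : 0 < T := by linarith
  -- k² T² ≤ B⁴
  have hkT : k ^ 2 * T ^ 2 ≤ B ^ 4 := by
    have h1 : k ^ 2 ≤ B ^ 2 := pow_le_pow_left₀ hk0.le hkB 2
    have h2 : T ^ 2 ≤ B ^ 2 := pow_le_pow_left₀ hT0.le hTB 2
    calc k ^ 2 * T ^ 2 ≤ B ^ 2 * B ^ 2 := mul_le_mul h1 h2 (by positivity) (by positivity)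
      _ = B ^ 4 := by ring
  -- first term ≥ B^10 / 16
  have h1 : B ^ 10 / 16 ≤ 1 / (16 * k ^ 2 * T ^ 2) * B ^ 14 := by
    rw [div_mul_eq_mul_div, one_mul, div_le_div_iff₀ (by norm_num) (by positivity)]
    calc B ^ 10 * (16 * k ^ 2 * T ^ 2) = 16 * B ^ 10 * (k ^ 2 * T ^ 2) := by ring
      _ ≤ 16 * B ^ 10 * B ^ 4 := by gcongr
      _ = B ^ 14 * 16 := by ring
  -- second term ≤ 2 B^7
  have h2 : 2 * u * B ^ 14 ≤ 2 * B ^ 7 := by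
    have : u * B ^ 14 = (u * B ^ 7) * B ^ 7 := by ring
    nlinarith [pow_nonneg hB0.le 7]
  -- B + 2 B^7 ≤ B^10/16
  have h3 : B + 2 * B ^ 7 ≤ B ^ 10 / 16 := by
    rw [le_div_iff₀ (by norm_num)]
    have hB3 : 64 ≤ B ^ 3 := by
      have := pow_le_pow_left₀ (by norm_num : (0 : ℝ) ≤ 4) hB 3
      norm_num at this
      exact this
    have hB6 : 1 ≤ B ^ 6 := one_le_pow₀ (by linarith)
    nlinarith [pow_nonneg hB0.le 7, pow_nonneg hB0.le 6]
  nlinarith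

/-- **The gate bounds are small**: with `a = B¹⁴`, `B ≥ 2|x| + k + T + 4`, and `θ = 1/(16k²T²)`,
every query gate has gate bound at most `exp(−(2|x| + k))/T` (for a large table, `2^{2n} > B¹⁴`
gives `(e−1)·2^{-n} ≤ 2B^{-7} ≤ θ/2` and `θ·B¹⁴/2 ≥ B ≥ 2|x| + k + T ≥ 2|x| + k + ln T`).
[cite: AaronsonChen2017, §5.3 (pp. 22–23, τ = ε⁴/(96T²(2n + ε⁻¹ + ln T)) and eq. (9))] -/
theorem AcSim.gateBound_oracle_le {Bn a k T xl : ℕ} (ha : a = Bn ^ 14) (hk : 0 < k) (hT : 0 < T)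
    (hBn : 2 * xl + k + T + 4 ≤ Bn) {kq : ℕ} (e : Fin (kq + 1) ↪ Fin N) :
    AcSim.gateBound (G := G) (1 / (16 * (k : ℝ) ^ 2 * (T : ℝ) ^ 2)) a a (QGate.oracle kq e) ≤
      Real.exp (-(2 * (xl : ℝ) + k)) / T := by
  simp only [AcSim.gateBound]
  split_ifs with h
  · obtain ⟨⟨m, hm⟩, hkq, hlt⟩ := h
    have hdiv : (kq - 1) / 2 = m := by omega
    rw [hdiv]
    -- B^7 < 2^m in ℕ
    have h2m : Bn ^ 7 < 2 ^ m := by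
      have : (Bn ^ 7) ^ 2 < (2 ^ m) ^ 2 := by
        rw [← pow_mul, ← pow_mul, show m * 2 = kq - 1 by omega, ← ha]
        exact hlt
      exact (Nat.pow_lt_pow_iff_left two_ne_zero).1 this
    -- real parameters
    have hTpos : (0 : ℝ) < T := by exact_mod_cast hT
    have hT1 : (1 : ℝ) ≤ T := by exact_mod_cast hT
    have hk1 : (1 : ℝ) ≤ k := by exact_mod_cast hk
    have hBn' : (2 * xl + k + T + 4 : ℝ) ≤ Bn := by exact_mod_cast hBn
    have hxl : (0 : ℝ) ≤ xl := Nat.cast_nonneg _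
    have hB4 : (4 : ℝ) ≤ Bn := by linarith
    have hkB : (k : ℝ) ≤ Bn := by linarith
    have hTB : (T : ℝ) ≤ Bn := by linarith
    have hu : (2⁻¹ : ℝ) ^ m * (Bn : ℝ) ^ 7 ≤ 1 := by
      have h' : ((Bn : ℝ)) ^ 7 < 2 ^ m := by exact_mod_cast h2m
      rw [inv_pow, inv_mul_le_iff₀ (by positivity), mul_one]
      exact h'.le
    have harith := param_arith hB4 hk1 hkB hT1 hTB hu
    have he : (Real.exp 1 - 1) * (2⁻¹ : ℝ) ^ m ≤ 2 * 2⁻¹ ^ m :=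
      mul_le_mul_of_nonneg_right exp_one_sub_one_le_two (by positivity)
    have hlog : Real.log T ≤ T := (Real.log_le_sub_one_of_pos hTpos).trans (by linarith)
    have hB14 : (0 : ℝ) ≤ (Bn : ℝ) ^ 14 := by positivity
    have hmono : (1 / (16 * (k : ℝ) ^ 2 * (T : ℝ) ^ 2) - 2 * 2⁻¹ ^ m) * (Bn : ℝ) ^ 14 ≤
        (1 / (16 * (k : ℝ) ^ 2 * (T : ℝ) ^ 2) - (Real.exp 1 - 1) * 2⁻¹ ^ m) * (Bn : ℝ) ^ 14 :=
      mul_le_mul_of_nonneg_right (by linarith) hB14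
    have ha' : ((a : ℕ) : ℝ) = (Bn : ℝ) ^ 14 := by rw [ha]; push_cast; ring
    calc Real.exp (-((1 / (16 * (k : ℝ) ^ 2 * (T : ℝ) ^ 2) - (Real.exp 1 - 1) * 2⁻¹ ^ m)) * (a : ℝ))
        ≤ Real.exp (-(2 * (xl : ℝ) + k) - Real.log T) := by
          refine Real.exp_le_exp.2 ?_
          rw [ha', neg_mul]
          linarith
      _ = Real.exp (-(2 * (xl : ℝ) + k)) / T := by
          rw [Real.exp_sub, Real.exp_log hTpos]
  · positivity

/-! ### Proof of `aaronsonChen2017_lem53_losses` -/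

/-- `2·T·√(1/(16k²T²)) = 1/(2k)`. [folklore] -/
theorem two_mul_mul_sqrt_theta {k T : ℝ} (hk : 0 < k) (hT : 0 < T) :
    2 * T * Real.sqrt (1 / (16 * k ^ 2 * T ^ 2)) = 1 / (2 * k) := by
  rw [show (1 : ℝ) / (16 * k ^ 2 * T ^ 2) = (1 / (4 * k * T)) ^ 2 by field_simp; ring,
    Real.sqrt_sq (by positivity)]
  field_simp
  ring

/-- **Aaronson–Chen 2017, Lemma 5.3, the probabilistic half: `aaronsonChen2017_lem53_losses` holds**
(with the budget exponent `c = 14`). Over the coins of `𝒟_O`: the error terms of the replaced run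
are those of the process started from the local constant stage `|input, 0^m⟩`; by the union bound
along the gates (`AcSim.IsLocal.measureReal_exists_loss_gt_le`) and the smallness of the gate
bounds (`AcSim.gateBound_oracle_le`), some error term exceeds `θ = 1/(16k²T²)` with probability at
most `T · exp(−(2|x| + k))/T`; otherwise `Σ_t 2√X_t ≤ 2T√θ = 1/2k`; finally the event is pushed
forward to `𝒟_O = acOracleOf_* (coins)`.
[cite: AaronsonChen2017, §5.3 (pp. 22–23, eqs. (8)–(10) and the union bound)] -/
theorem aaronsonChen2017_lem53_losses_holds : aaronsonChen2017_lem53_losses := by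
  intro F
  refine ⟨14, fun x k hk => ?_⟩
  have hlen : (boolPair x (unaryEncodeNat k)).length = 2 * x.length + 2 + k := by
    have h : (unaryEncodeNat k).length = k := unary_decode_encode_nat k
    rw [length_boolPair, h]
  generalize boolPair x (unaryEncodeNat k) = input at hlen ⊢
  have hkr : (0 : ℝ) < k := by exact_mod_cast hk
  have hexp_pos := Real.exp_pos (-(2 * (x.length : ℝ) + k))
  -- the number of query gates
  set T : ℕ := (F.circ input.length).oracleQueries with hTdef
  have hqT : ((⟨(F.circ input.length).gates⟩ : QCircuit cliffordT _).oracleQueries) = T := rfl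
  have hlosses : ∀ O : Set (List Bool), acSimLosses F O 14 input =
      AcSim.losses O (acSimParam 14 input T) (acSimParam 14 input T) (F.circ input.length).gates
        (acSimInit F input) := fun O => rfl
  have hlenL : ∀ O : Set (List Bool), (acSimLosses F O 14 input).length = T := fun O => by
    rw [hlosses, AcSim.length_losses, hqT]
  -- Case `T = 0`: no error terms, the event is sure
  by_cases hT : T = 0
  · have hall : ∀ O : Set (List Bool),
        ((acSimLosses F O 14 input).map fun q => 2 * Real.sqrt q).sum ≤ 1 / (2 * (k : ℝ)) := by
      intro O
      rw [List.length_eq_zero_iff.1 ((hlenL O).trans hT)]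
      simp only [List.map_nil, List.sum_nil]
      positivity
    rw [Set.eq_univ_of_forall (s := {O : Set (List Bool) |
      ((acSimLosses F O 14 input).map fun q => 2 * Real.sqrt q).sum ≤ 1 / (2 * (k : ℝ))}) hall, probReal_univ]
    linarith
  -- `T ≥ 1`
  have hTpos : 0 < T := Nat.pos_of_ne_zero hT
  have hTr : (0 : ℝ) < T := by exact_mod_cast hTpos
  have hθpos : (0 : ℝ) < 1 / (16 * (k : ℝ) ^ 2 * (T : ℝ) ^ 2) := by positivity
  have ha1 : 1 ≤ acSimParam 14 input T := Nat.one_le_pow _ _ (by omega)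
  have hσ : AcSim.IsLocal (fun _ : Set (List Bool) => acSimInit F input) :=
    AcSim.isLocal_const (normSq_basisState _)
  -- the bad event on the coin space
  have hbad : acCoinMeasure.real {S | ∃ q ∈ acSimLosses F (acOracleOf S) 14 input,
      1 / (16 * (k : ℝ) ^ 2 * (T : ℝ) ^ 2) < q} ≤ Real.exp (-(2 * (x.length : ℝ) + k)) := by
    have h1 := AcSim.IsLocal.measureReal_exists_loss_gt_le cliffordT_isUnitary_holds ha1
      (acSimParam 14 input T) hθpos (F.circ input.length).gates hσ
    simp only [← hlosses] at h1
    refine h1.trans ?_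
    have h2 := AcSim.sum_map_gateBound_le (G := cliffordT) (θ := 1 / (16 * (k : ℝ) ^ 2 * (T : ℝ) ^ 2))
      (a := acSimParam 14 input T) (b := acSimParam 14 input T) (div_pos hexp_pos hTr).le
      (F.circ input.length).gates fun kq e _ =>
        AcSim.gateBound_oracle_le (Bn := input.length + T + 2) (xl := x.length) rfl hk hTpos (by omega) e
    rw [hqT] at h2
    refine h2.trans (le_of_eq ?_)
    field_simp
  -- the good event contains the complement of the bad event
  have hgood : ∀ S : Set AcCoin,
      (∀ q ∈ acSimLosses F (acOracleOf S) 14 input, q ≤ 1 / (16 * (k : ℝ) ^ 2 * (T : ℝ) ^ 2)) →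
        ((acSimLosses F (acOracleOf S) 14 input).map fun q => 2 * Real.sqrt q).sum ≤ 1 / (2 * (k : ℝ)) := by
    intro S hS
    refine (sum_map_two_mul_sqrt_le_of_forall_le hS).trans (le_of_eq ?_)
    rw [hlenL, two_mul_mul_sqrt_theta hkr hTr]
  have hcoin : 1 - Real.exp (-(2 * (x.length : ℝ) + k)) ≤
      acCoinMeasure.real {S | ((acSimLosses F (acOracleOf S) 14 input).map
        fun q => 2 * Real.sqrt q).sum ≤ 1 / (2 * (k : ℝ))} := by
    have hunion : (Set.univ : Set (Set AcCoin)) ⊆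
        {S | ((acSimLosses F (acOracleOf S) 14 input).map fun q => 2 * Real.sqrt q).sum ≤ 1 / (2 * (k : ℝ))} ∪
          {S | ∃ q ∈ acSimLosses F (acOracleOf S) 14 input, 1 / (16 * (k : ℝ) ^ 2 * (T : ℝ) ^ 2) < q} := by
      intro S _
      by_cases h : ∃ q ∈ acSimLosses F (acOracleOf S) 14 input, 1 / (16 * (k : ℝ) ^ 2 * (T : ℝ) ^ 2) < q
      · exact Or.inr h
      · push Not at h
        exact Or.inl (hgood S h)
    have := (measureReal_mono (μ := acCoinMeasure) hunion (measure_ne_top _ _)).trans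
      (measureReal_union_le _ _)
    rw [probReal_univ] at this
    linarith
  -- push forward to `𝒟_O`
  refine hcoin.trans ?_
  exact ENNReal.toReal_mono (measure_ne_top _ _)
    (Measure.le_map_apply measurable_acOracleOf.aemeasurable _)

/-- **Lemma 5.3 is reduced to the machine fact**: `aaronsonChen2017_lem53` follows from
`aaronsonChen2017_lem53_machine` alone. [cite: AaronsonChen2017, Lemma 5.3 (p. 21; proof pp. 21–23)] -/
theorem aaronsonChen2017_lem53_of_machine (hM : aaronsonChen2017_lem53_machine) : aaronsonChen2017_lem53 :=
  aaronsonChen2017_lem53_of_parts hM aaronsonChen2017_lem53_losses_holds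

/-- **The state-closeness statement `aaronsonChen2017_lem53_analysis` holds** (eq. (10) with the
printed probability, target `1/2k`): from the losses fact, now proved, and
`aaronsonChen2017_lem53_analysis_of_losses`. [cite: AaronsonChen2017, §5.3 (p. 23, "Upper-bounding the error")] -/
theorem aaronsonChen2017_lem53_analysis_holds : aaronsonChen2017_lem53_analysis :=
  aaronsonChen2017_lem53_analysis_of_losses aaronsonChen2017_lem53_losses_holds

end Literature.Barriers.QuantumAdvantage

end
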